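import Summits.AtomisticToContinuum.Crystallization.Theorems.ThreeConeCertificateKeplerBoundBulkSite
import Summits.AtomisticToContinuum.Crystallization.Theorems.ChargedEnergyGap.Negative.BlocksBound

/-!
# `KeplerBound` (stmt-AtomisticToContinuum-11961) from local limits, II: a block of `P` matched
# inside a finite configuration

Support file for the item `ThreeConeCertificate.KeplerBound`.  Let `y : Fin N → ℝ³` be
`δ`-separated and two-way `ε`-matched with the `δ`-separated periodic configuration `P` on the
ball `‖·‖ ≤ L` (the matching clause of `IsLocalLimitOfGroundStates`), and let `i u` be the
particle within `ε` of the block point `bpt P K u` (`u : BIdx P K`, the `#F·K³` points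
`x + Σ kᵢ bᵢ`, `0 ≤ kᵢ < K`, of `ChargedEnergyGap/Negative/BlocksEnergy.lean`).  Then

* `sum_siteSum_bpt`: `Σ_u siteSum P V (bpt u) = 2·#block·e(P)` (translation invariance);
* `siteEnergy_ge_of_near`: the site energy of a particle within `ε` of a point `p ∈ P` deep
  inside the matched ball is `≥ Σ_{q ∈ T_p} V_LJ(dist q p) − #T_p·ω − (250/6)δ⁻⁵/(t₀ − 1)`
  (part IIc with the identity chart);
* `sum_siteEnergy_block_ge`: summed over the block,
  `Σ_u 𝓔^{i u}(y) ≥ 2·#block·e(P) − #block·(M ω + (250/6)δ⁻⁵/(t₀ − 1))`, `M = (2t₀/δ + 1)³`;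
* `sum_sum_block_le`: the pair sum over the matched particles is at most
  `2·𝓔(blockConfig P K) + #block²·ω₂` (distances distorted by `≤ 2ε`).

All `[folklore]`.
-/

noncomputable section

open scoped BigOperators Topology
open Filter Set Metric

namespace Summit.AtomisticToContinuum.Crystallization.Theorems.KeplerBoundLocalLimit

open Literature.MathematicalPhysics.StatisticalMechanics
open Summit.AtomisticToContinuum.Crystallization.Theorems.SlackRigidityNegative (E3)
open Summit.AtomisticToContinuum.Crystallization.Theorems.KeplerBoundBulk
open Summit.AtomisticToContinuum.Crystallization.Theorems.ChargedEnergyGapNegative.Blocks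

variable (P : PeriodicConfiguration 3) (K : ℕ)

/-! ## § The block's site sums -/

/-- **Site sums over a block**: `Σ_u siteSum P V (bpt u) = 2 · #block · e(P)`. [folklore] -/
theorem sum_siteSum_bpt (V : ℝ → ℝ) :
    ∑ u : BIdx P K, siteSum P V (bpt P K u) =
      2 * (Fintype.card (BIdx P K) : ℝ) * P.energyPerParticle V := by
  have h1 : ∑ u : BIdx P K, siteSum P V (bpt P K u) = ∑ u : BIdx P K, siteSum P V u.1 :=
    Finset.sum_congr rfl fun u _ => siteSum_bpt P K V u
  rw [h1, Fintype.sum_prod_type]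
  simp only [Finset.sum_const, Finset.card_univ, Fintype.card_fun, Fintype.card_fin, nsmul_eq_mul]
  rw [← Finset.mul_sum, Finset.sum_coe_sort P.motif (siteSum P V), sum_siteSum_eq, card_BIdx]
  push_cast
  ring

variable {P K}

/-! ## § One particle near a deep point of `P` -/

/-- **Site energy of a particle near a point of `P`, identity chart.** If `y` and `P` are
two-way `ε`-matched on `‖·‖ ≤ L`, `p ∈ P.points` with `‖p‖ + t₀ + 1 ≤ L`, and the particle `y i`
is within `ε` of `p` (`4ε < δ`, `2ε ≤ 1`, `t₀ ≥ 2`, both `y` and `P` `δ`-separated), then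
`𝓔ⁱ(y) ≥ Σ_{q ∈ T} V_LJ(dist q p) − #T·ω − (250/6)δ⁻⁵/(t₀ − 1)` with
`T = {q ∈ P.points : q ≠ p, dist q p ≤ t₀}` and `ω` a modulus of `V_LJ` on `[δ, t₀ + 1]` at scale
`2ε`. [folklore] -/
theorem siteEnergy_ge_of_near {p : E3} (hp : p ∈ P.points) {N : ℕ} {y : Fin N → E3} {i : Fin N}
    {δ ε t₀ L ω : ℝ} {T : Finset E3}
    (hT : ∀ q, q ∈ T ↔ q ∈ P.points ∧ q ≠ p ∧ dist q p ≤ t₀)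
    (hm1 : ∀ q ∈ P.points, ‖q‖ ≤ L → ∃ j, dist (y j) q ≤ ε)
    (hm2 : ∀ j, ‖y j‖ ≤ L → ∃ q ∈ P.points, dist (y j) q ≤ ε)
    (hL : ‖p‖ + t₀ + 1 ≤ L) (hi : dist (y i) p ≤ ε)
    (hsep : ∀ k l, k ≠ l → δ ≤ dist (y k) (y l))
    (hPsep : ∀ p ∈ P.points, ∀ q ∈ P.points, p ≠ q → δ ≤ dist p q)
    (hδ : 0 < δ) (hε : 0 ≤ ε) (hεδ : 4 * ε < δ) (hε1 : 2 * ε ≤ 1) (ht₀ : 2 ≤ t₀)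
    (hω : ∀ s t : ℝ, δ ≤ s → δ ≤ t → s ≤ t₀ + 1 → t ≤ t₀ + 1 → |s - t| ≤ 2 * ε →
      |lennardJones s - lennardJones t| ≤ ω) :
    ∑ q ∈ T, lennardJones (dist q p) - T.card * ω - 1 / 6 * ((t₀ - 1)⁻¹ * (250 * δ⁻¹ ^ 5)) ≤
      siteEnergy lennardJones y i := by
  have hip : dist p (y i) ≤ ε := by rwa [dist_comm] at hi
  set I : E3 →ₗᵢ[ℝ] E3 := LinearIsometry.id with hI
  have hIapp : ∀ v : E3, I v = v := fun v => rfl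
  -- the shifted image point `y i + (q - p)` is within `ε` of `q`
  have hshift : ∀ q : E3, dist q (y i + I (q - p)) ≤ ε := fun q => by
    rw [hIapp, dist_eq_norm]
    have e : q - (y i + (q - p)) = p - y i := by abel
    rw [e, ← dist_eq_norm]
    exact hip
  have ha : ∀ q ∈ P.points, dist q p ≤ t₀ → ∃ j, dist (y j) (y i + I (q - p)) ≤ 2 * ε := by
    intro q hq hqt
    have hqn : ‖q‖ ≤ L := by
      have h1 : ‖q‖ ≤ ‖q - p‖ + ‖p‖ := norm_le_norm_sub_add q p
      rw [← dist_eq_norm] at h1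
      linarith
    obtain ⟨j, hj⟩ := hm1 q hq hqn
    refine ⟨j, ?_⟩
    calc dist (y j) (y i + I (q - p))
        ≤ dist (y j) q + dist q (y i + I (q - p)) := dist_triangle _ _ _
      _ ≤ ε + ε := add_le_add hj (hshift q)
      _ = 2 * ε := by ring
  have hb : ∀ j, dist (y j) (y i) ≤ t₀ →
      ∃ q ∈ P.points, dist (y j) (y i + I (q - p)) ≤ 2 * ε := by
    intro j hj
    have hyi : ‖y i‖ ≤ ε + ‖p‖ := by
      have h1 : ‖y i‖ ≤ ‖y i - p‖ + ‖p‖ := norm_le_norm_sub_add (y i) p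
      rw [← dist_eq_norm] at h1
      linarith
    have hjn : ‖y j‖ ≤ L := by
      have h1 : ‖y j‖ ≤ ‖y j - y i‖ + ‖y i‖ := norm_le_norm_sub_add (y j) (y i)
      rw [← dist_eq_norm] at h1
      linarith
    obtain ⟨q, hq, hjq⟩ := hm2 j hjn
    refine ⟨q, hq, ?_⟩
    calc dist (y j) (y i + I (q - p))
        ≤ dist (y j) q + dist q (y i + I (q - p)) := dist_triangle _ _ _
      _ ≤ ε + ε := add_le_add hjq (hshift q)
      _ = 2 * ε := by ring
  exact siteEnergy_ge_of_matchedAt (ε := 2 * ε) hT hp ha hb hsep hPsep hδ (by linarith)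
    (by linarith) hε1 ht₀ hω

/-- **Packing count near a point of `P`**: `#{q ∈ P.points : q ≠ p, dist q p ≤ t₀} ≤ (2t₀/δ + 1)³`
for `δ`-separated `P`. [folklore] -/
theorem card_near_le {p : E3} {δ t₀ : ℝ} {T : Finset E3}
    (hT : ∀ q, q ∈ T ↔ q ∈ P.points ∧ q ≠ p ∧ dist q p ≤ t₀)
    (hPsep : ∀ p ∈ P.points, ∀ q ∈ P.points, p ≠ q → δ ≤ dist p q) (hδ : 0 < δ) (ht₀ : 0 ≤ t₀) :
    (T.card : ℝ) ≤ (2 * t₀ / δ + 1) ^ 3 := by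
  have h := card_le_of_separated_of_dist_le T p hδ ht₀ (fun c hc => ((hT c).1 hc).2.2)
    (fun c hc d hd hcd => hPsep c ((hT c).1 hc).1 d ((hT d).1 hd).1 hcd)
  rwa [finrank_euclideanSpace_fin] at h

/-! ## § The whole block -/

/-- **Site energies over a matched block.** With `i u` the particle within `ε` of `bpt u` and
every block point deep inside the matched ball,
`Σ_u 𝓔^{i u}(y) ≥ 2·#block·e(P) − #block·((2t₀/δ + 1)³ ω + (250/6)δ⁻⁵/(t₀ − 1))`. [folklore] -/
theorem sum_siteEnergy_block_ge {N : ℕ} {y : Fin N → E3} (i : BIdx P K → Fin N)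
    {δ ε t₀ L ω : ℝ}
    (hm1 : ∀ q ∈ P.points, ‖q‖ ≤ L → ∃ j, dist (y j) q ≤ ε)
    (hm2 : ∀ j, ‖y j‖ ≤ L → ∃ q ∈ P.points, dist (y j) q ≤ ε)
    (hL : ∀ u, ‖bpt P K u‖ + t₀ + 1 ≤ L) (hi : ∀ u, dist (y (i u)) (bpt P K u) ≤ ε)
    (hsep : ∀ k l, k ≠ l → δ ≤ dist (y k) (y l))
    (hPsep : ∀ p ∈ P.points, ∀ q ∈ P.points, p ≠ q → δ ≤ dist p q)
    (hδ : 0 < δ) (hε : 0 ≤ ε) (hεδ : 4 * ε < δ) (hε1 : 2 * ε ≤ 1) (ht₀ : 2 ≤ t₀) (hω0 : 0 ≤ ω)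
    (hω : ∀ s t : ℝ, δ ≤ s → δ ≤ t → s ≤ t₀ + 1 → t ≤ t₀ + 1 → |s - t| ≤ 2 * ε →
      |lennardJones s - lennardJones t| ≤ ω) :
    2 * (Fintype.card (BIdx P K) : ℝ) * P.energyPerParticle lennardJones -
        (Fintype.card (BIdx P K) : ℝ) *
          ((2 * t₀ / δ + 1) ^ 3 * ω + 1 / 6 * ((t₀ - 1)⁻¹ * (250 * δ⁻¹ ^ 5))) ≤
      ∑ u : BIdx P K, siteEnergy lennardJones y (i u) := by
  classical
  have hper : ∀ u : BIdx P K, siteSum P lennardJones (bpt P K u) -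
      ((2 * t₀ / δ + 1) ^ 3 * ω + 1 / 6 * ((t₀ - 1)⁻¹ * (250 * δ⁻¹ ^ 5))) ≤
        siteEnergy lennardJones y (i u) := by
    intro u
    set p := bpt P K u with hp_def
    have hp : p ∈ P.points := bpt_mem P K u
    have hfin : (closedBall p t₀ ∩ P.points).Finite := P.finite_inter_points isBounded_closedBall
    obtain ⟨T, hT⟩ : ∃ T : Finset E3, ∀ q, q ∈ T ↔ q ∈ P.points ∧ q ≠ p ∧ dist q p ≤ t₀ := by
      refine ⟨hfin.toFinset.erase p, fun q => ?_⟩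
      rw [Finset.mem_erase, Set.Finite.mem_toFinset, Set.mem_inter_iff, mem_closedBall]
      constructor
      · rintro ⟨h1, h2, h3⟩; exact ⟨h3, h1, h2⟩
      · rintro ⟨h1, h2, h3⟩; exact ⟨h2, h3, h1⟩
    have h1 := siteEnergy_ge_of_near hp hT hm1 hm2 (hL u) (hi u) hsep hPsep hδ hε hεδ hε1 ht₀ hω
    have h2 := siteSum_le_sum_near P (by linarith : (1 : ℝ) ≤ t₀) hT
    have h3 := card_near_le hT hPsep hδ (by linarith)
    have h4 : (T.card : ℝ) * ω ≤ (2 * t₀ / δ + 1) ^ 3 * ω := mul_le_mul_of_nonneg_right h3 hω0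
    linarith
  have hsum := Finset.sum_le_sum fun u (_ : u ∈ Finset.univ) => hper u
  rw [Finset.sum_sub_distrib, sum_siteSum_bpt, Finset.sum_const, Finset.card_univ, nsmul_eq_mul]
    at hsum
  exact hsum

/-- **Pair sums over a matched block.** If moreover `u ↦ i u` is injective and all block pair
distances are `≤ D`, then for a modulus `ω₂ ≥ 0` of `V_LJ` on `[δ, D + 1]` at scale `2ε`,
`Σ_u Σ_v V_LJ(|y (i u) − y (i v)|) ≤ 2·𝓔(blockConfig P K) + #block²·ω₂`. [folklore] -/
theorem sum_sum_block_le {N : ℕ} {y : Fin N → E3} (i : BIdx P K → Fin N)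
    (hinj : Function.Injective i) {δ ε D ω₂ : ℝ} (hi : ∀ u, dist (y (i u)) (bpt P K u) ≤ ε)
    (hsep : ∀ k l, k ≠ l → δ ≤ dist (y k) (y l))
    (hPsep : ∀ p ∈ P.points, ∀ q ∈ P.points, p ≠ q → δ ≤ dist p q)
    (hε1 : 2 * ε ≤ 1) (hD : ∀ u v, dist (bpt P K u) (bpt P K v) ≤ D) (hω0 : 0 ≤ ω₂)
    (hω₂ : ∀ s t : ℝ, δ ≤ s → δ ≤ t → s ≤ D + 1 → t ≤ D + 1 → |s - t| ≤ 2 * ε →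
      |lennardJones s - lennardJones t| ≤ ω₂) :
    ∑ u : BIdx P K, ∑ v : BIdx P K, lennardJones (dist (y (i u)) (y (i v))) ≤
      2 * interactionEnergy lennardJones (blockConfig P K) +
        (Fintype.card (BIdx P K) : ℝ) ^ 2 * ω₂ := by
  rw [two_mul_energy_blockConfig]
  have hterm : ∀ u v : BIdx P K, lennardJones (dist (y (i u)) (y (i v))) ≤
      lennardJones (dist (bpt P K u) (bpt P K v)) + ω₂ := by
    intro u v
    by_cases huv : u = v
    · subst huv
      rw [dist_self, dist_self]
      linarith
    · have hne : i u ≠ i v := fun h => huv (hinj h)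
      have hne' : bpt P K u ≠ bpt P K v := fun h => huv (bpt_injective P K h)
      have hs : δ ≤ dist (y (i u)) (y (i v)) := hsep _ _ hne
      have ht : δ ≤ dist (bpt P K u) (bpt P K v) := hPsep _ (bpt_mem P K u) _ (bpt_mem P K v) hne'
      have hdiff : |dist (y (i u)) (y (i v)) - dist (bpt P K u) (bpt P K v)| ≤ 2 * ε := by
        have h1 := dist_dist_dist_le (y (i u)) (y (i v)) (bpt P K u) (bpt P K v)
        rw [Real.dist_eq] at h1
        linarith [hi u, hi v]
      have hd' := abs_sub_le_iff.1 hdiff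
      have hbd := hD u v
      have := hω₂ _ _ hs ht (by linarith) (by linarith) hdiff
      linarith [(abs_sub_le_iff.1 this).1]
  calc ∑ u : BIdx P K, ∑ v : BIdx P K, lennardJones (dist (y (i u)) (y (i v)))
      ≤ ∑ u : BIdx P K, ∑ v : BIdx P K, (lennardJones (dist (bpt P K u) (bpt P K v)) + ω₂) :=
        Finset.sum_le_sum fun u _ => Finset.sum_le_sum fun v _ => hterm u v
    _ = ∑ u : BIdx P K, ∑ v : BIdx P K, lennardJones (dist (bpt P K u) (bpt P K v)) +
          (Fintype.card (BIdx P K) : ℝ) ^ 2 * ω₂ := by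
        simp only [Finset.sum_add_distrib, Finset.sum_const, Finset.card_univ, nsmul_eq_mul]
        ring

end Summit.AtomisticToContinuum.Crystallization.Theorems.KeplerBoundLocalLimit

end
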